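import Mathlib
import Summits.ValiantsHypothesis.ValiantsHypothesis.Theorems.LacunarySymmetroidMatrixDescartesDefiniteMomentsMDR

/-!
# `MatrixDescartes` (stmt-ValiantsHypothesis-18050) — the DEFINITE-MOMENTS LAW, IX: the bridge row to the
# det-real-rooted («hyperbolic door») currency — `deg det ≤ 2m(K−1) + 1` on the Rayleigh-hyperbolic sector

HONEST FRAMING.  Cell `pub-symmetroid`, seat `val-sym-mdr-p2` (gen 14); helper file `--supports` the crux
`Theses.LacunarySymmetroid.MatrixDescartes`, NO closure claim.  Desk R2399 (B) asked for the relation to val-idea-6's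
door `Cruxes/MatrixDescartes/Lines/hyperbolic.lean`, whose rows `HypRootLawAt m K B` say: every real symmetric `(m,K)`
pencil whose DETERMINANT is real-rooted with simple roots (`IsRealRootedSimple p := p.roots.toFinset.card = p.natDegree`)
has `deg det ≤ B`; its linear row `HyperbolicLinearLaw` (`B = 2m(K−1)+1`) is REFUTED there (`not_hypRootLawAt_two_four_13`,
crit-1's `η(2,4) = 14` with four indefinite letters).  The two notions of «hyperbolic» differ: the door's is a property
of the polynomial `det F`; the definite-moments law's is a property of the pencil as a family of quadratic forms on
`(0,∞)` (K alternating definite scales ⇔ Rayleigh K-nomials Descartes-sharp with separated zones).  THIS FILE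
(`natDegree_det_le_on_rayleighHyperbolic`): on pencils that are Rayleigh-hyperbolic for BOTH `F(X)` and `F(−X)` AND whose
determinant is real-rooted-simple (the hypothesis `IsRealRootedSimple` UNFOLDED, since crux workfiles are not importable
here), `deg det F ≤ 2m(K−1) + 1` — the refuted linear row's bound holds verbatim on the intersection of the two sectors
(so crit-1's witness lies outside the Rayleigh-hyperbolic sector, as it must: that sector forces definite alternating
letters).  A corollary of `alternatingMoments_realRoots_le`; nothing on `HyperbolicLaw`/H3, the doors, registers, or
`VP ≠ VNP`.  [folklore]; axioms standard; no definitions.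
-/

-- layout Summits/ValiantsHypothesis/ValiantsHypothesis forces the duplicated namespace component
set_option linter.dupNamespace false

namespace Summit.ValiantsHypothesis.ValiantsHypothesis.Theorems.LacunarySymmetroidMatrixDescartes

open Polynomial Matrix Finset
open scoped BigOperators

namespace DefiniteMoments

/-- **Bridge row (`HypRootLawAt` currency on the Rayleigh-hyperbolic sector).**  `F = ∑ₗ X^{dₗ} Sₗ`, real symmetric
`m × m` letters, `K ≤ V + 1`, `K ≤ V' + 1`; `F` definite with alternating signs at `V + 1` positive scales and `F(−X)` at
`V' + 1` positive scales; `det F` real-rooted with simple roots (`roots.toFinset.card = natDegree`).  Then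
`deg det F ≤ V·m + V'·m + 1` (for `V = V' = K − 1`: `2m(K−1) + 1`). [folklore] -/
theorem natDegree_det_le_on_rayleighHyperbolic (K m : ℕ) (d : Fin K → ℕ) (S : Fin K → Matrix (Fin m) (Fin m) ℝ)
    (hS : ∀ l, (S l).IsSymm) (V V' : ℕ) (hV : K ≤ V + 1) (hV' : K ≤ V' + 1)
    (a : Fin (V + 1) → ℝ) (ha : StrictMono a) (ha0 : 0 < a 0) (σ : ℝ)
    (hdef : ∀ (j : Fin (V + 1)) (v : Fin m → ℝ), v ≠ 0 →
      0 < σ * (-1) ^ (j : ℕ) * (v ⬝ᵥ ((∑ l, a j ^ d l • S l) *ᵥ v)))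
    (a' : Fin (V' + 1) → ℝ) (ha' : StrictMono a') (ha'0 : 0 < a' 0) (σ' : ℝ)
    (hdef' : ∀ (j : Fin (V' + 1)) (v : Fin m → ℝ), v ≠ 0 →
      0 < σ' * (-1) ^ (j : ℕ) * (v ⬝ᵥ ((∑ l, a' j ^ d l • (((-1 : ℝ) ^ d l) • S l)) *ᵥ v)))
    (hreal : (Matrix.det (∑ l, ((Polynomial.X : Polynomial ℝ) ^ d l) • (S l).map Polynomial.C)).roots.toFinset.card
      = (Matrix.det (∑ l, ((Polynomial.X : Polynomial ℝ) ^ d l) • (S l).map Polynomial.C)).natDegree) :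
    (Matrix.det (∑ l, ((Polynomial.X : Polynomial ℝ) ^ d l) • (S l).map Polynomial.C)).natDegree
      ≤ V * m + V' * m + 1 := by
  rw [← hreal]
  exact alternatingMoments_realRoots_le K m d S hS V V' hV hV' a ha ha0 σ hdef a' ha' ha'0 σ' hdef'

/-- The same with `V = V' = K − 1` written out: `deg det F ≤ 2m(K−1) + 1` — the bound of the (refuted, on the
det-real-rooted sector) linear row `HyperbolicLinearLaw`, valid on the Rayleigh-hyperbolic sector. [folklore] -/
theorem natDegree_det_le_linear_on_rayleighHyperbolic (K m : ℕ) (hK : 1 ≤ K) (d : Fin K → ℕ)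
    (S : Fin K → Matrix (Fin m) (Fin m) ℝ) (hS : ∀ l, (S l).IsSymm)
    (a : Fin (K - 1 + 1) → ℝ) (ha : StrictMono a) (ha0 : 0 < a 0) (σ : ℝ)
    (hdef : ∀ (j : Fin (K - 1 + 1)) (v : Fin m → ℝ), v ≠ 0 →
      0 < σ * (-1) ^ (j : ℕ) * (v ⬝ᵥ ((∑ l, a j ^ d l • S l) *ᵥ v)))
    (a' : Fin (K - 1 + 1) → ℝ) (ha' : StrictMono a') (ha'0 : 0 < a' 0) (σ' : ℝ)
    (hdef' : ∀ (j : Fin (K - 1 + 1)) (v : Fin m → ℝ), v ≠ 0 →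
      0 < σ' * (-1) ^ (j : ℕ) * (v ⬝ᵥ ((∑ l, a' j ^ d l • (((-1 : ℝ) ^ d l) • S l)) *ᵥ v)))
    (hreal : (Matrix.det (∑ l, ((Polynomial.X : Polynomial ℝ) ^ d l) • (S l).map Polynomial.C)).roots.toFinset.card
      = (Matrix.det (∑ l, ((Polynomial.X : Polynomial ℝ) ^ d l) • (S l).map Polynomial.C)).natDegree) :
    (Matrix.det (∑ l, ((Polynomial.X : Polynomial ℝ) ^ d l) • (S l).map Polynomial.C)).natDegree
      ≤ 2 * m * (K - 1) + 1 := by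
  have h := natDegree_det_le_on_rayleighHyperbolic K m d S hS (K - 1) (K - 1) (by omega) (by omega) a ha ha0 σ hdef
    a' ha' ha'0 σ' hdef' hreal
  have e : (K - 1) * m + (K - 1) * m + 1 = 2 * m * (K - 1) + 1 := by ring
  omega

end DefiniteMoments

end Summit.ValiantsHypothesis.ValiantsHypothesis.Theorems.LacunarySymmetroidMatrixDescartes
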